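import Mathlib.LinearAlgebra.Matrix.SchurComplement
import Mathlib.LinearAlgebra.Matrix.Symmetric
import Mathlib.LinearAlgebra.Matrix.Block
import Mathlib.Algebra.Ring.GeomSum
import Literature.Computability.AlgebraicComplexity.DetInVP
import Literature.Computability.AlgebraicComplexity.SymmetricDetRepresentation
import HarnessLib

/-!
# Proof of `GKKP2011_detPoly_symmetric` (Grenet–Kaltofen–Koiran–Portier 2011, Thm. 5)

Discharge (D-0014) of the named fact
`Literature.Computability.AlgebraicComplexity.GKKP2011_detPoly_symmetric`
(`SymmetricDetRepresentation.lean`): over a field `k` with `2 ≠ 0`, the generic determinant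
`DET_n = detPoly (Fin n) k` is the determinant of a SYMMETRIC matrix of dimension exactly `4n³ + 7`
whose entries are variables `X_{ij}` or constants `0, 1, -1, 1/2` — B. Grenet, E. L. Kaltofen,
P. Koiran, N. Portier, Contemp. Math. 556 (2011) 61–96 = arXiv:1007.3804, §3.2, Theorem 5
(M. Mahajan and P. Nimbhorkar), read as `paper:arxiv-1007.3804`, pp. 13–14.

## The printed proof and what is formalised

GKKP, proof of Thm. 5: take the Mahajan–Vinay branching program `G` for `DET_n` (a layered acyclic
graph, `2n³ + 3` vertices with the sinks, edge weights `0`, `1` or a variable), duplicate every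
internal vertex `u` into `u_in, u_out` linked by an edge of weight `1`, put the weight of the edge
`(u, v)` on `u_out — v_in` (the symmetric graph `G_s`, `4n³ + 6` vertices), and add one vertex
`c` joined to `t_in` with weight `1/2` and to `s_out` with weight `±1`; the adjacency matrix `M`
of this graph `Ḡ` (`4n³ + 7` vertices) satisfies `det M = DET_n`, by comparing cycle covers of `Ḡ`
(an odd cycle through `c` = an `s`–`t` path in either direction, the rest has a unique cover by
the links) with the `s`–`t` paths of `G`.

This file builds exactly this matrix (`symOfABP`, block form: corner block on `c, s_out, t_in`,
border block = edges out of the source / into the sink, middle block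
`[[0, 1 + Nᵀ], [1 + N, 0]]` on the `in`/`out` copies, `N` = internal adjacency matrix) and
proves `det M = DET_n` ALGEBRAICALLY instead of by counting cycle covers:

* **Symmetrization** (`det_symOfABP`): by the Schur complement of the (unipotent, hence
  invertible) middle block, `det M = (-1)^{|V|} · (−2 ε η · a (1+N)⁻¹ b)` where `a, b` are the
  source/sink weights, `ε, η` the two weights at `c`; `(1 + N)⁻¹ = ∑_j (−N)^j` sums the signed
  path weights of the branching program (`IsLayered`: all maximal paths have the same length).
* **The branching program for `DET_n`** (Mahajan–Vinay 1997, §3: states = (parity, head, current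
  vertex, number of edges); here heads are the LARGEST vertex of their clow and increase along a
  clow sequence, which is Berkowitz's orientation): `n` layers of the `2n²` states
  `(Fin n × Fin n) × Bool` plus the two pre-sinks `t₊, t₋`, so `|V| = 2n³ + 2` and the matrix has
  dimension `3 + 2|V| = 4n³ + 7` on the nose. Its correctness (`sum_sv_diag`: the signed number of
  clow sequences of length `n` is `[X^0] χ = (-1)^n DET_n`) is proved through the tree's
  Berkowitz recursion `Literature.Computability.AlgebraicComplexity.Berkowitz.chi_succ_coeff`
  (Samuelson's identity) together with Cayley–Hamilton (`sum_coeff_smul_pow_eq_zero`: the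
  over-long clows cancel in aggregate) — instead of Mahajan–Vinay's combinatorial involution.

Deviations from the printed proof: none in the construction (same graph, same size, same entry
set; our sign `ε` at `c — s_out` is the one making `det M = +DET_n` for our parity convention);
the two counting arguments are replaced by the block-determinant computation and by Berkowitz's
recursion, both available algebra in Mathlib/the tree.

## References

* [GrenetEtAl2011] B. Grenet, E. L. Kaltofen, P. Koiran, N. Portier, *Symmetric determinantal
  representation of weakly-skew circuits*, Contemp. Math. 556 (2011) 61–96, arXiv:1007.3804,
  §3.2 Thm. 5 and its proof (pp. 13–14 of the arXiv version).
* [MahajanVinay1997] M. Mahajan, V. Vinay, *Determinant: combinatorics, algorithms, and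
  complexity*, Chicago J. Theoret. Comput. Sci. 1997, Art. 5, §3 (clow sequences, Thm. 2; the
  branching program for the determinant).
* [Soltys2002] M. Soltys, *Berkowitz's algorithm and clow sequences*, Electron. J. Linear Algebra
  9 (2002) 42–54, §2–3 (Berkowitz's recursion; its reading by clow sequences).
* [Berkowitz1984] S. J. Berkowitz, Inform. Process. Lett. 18 (1984) 147–150.
-/

noncomputable section

namespace Literature.Computability.AlgebraicComplexity

namespace GKKP2011

open Matrix Finset MvPolynomial Berkowitz

universe u

/-! ## Part A. Symmetrization of a layered branching program -/


section Symmetrization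

variable {V : Type*} [Fintype V] [DecidableEq V] {R : Type*} [CommRing R]

/-- The corner block on the three special vertices `c, s_out, t_in` of the graph `Ḡ` of
Grenet–Kaltofen–Koiran–Portier (proof of Thm. 5): `c — s_out` of weight `ε`, `c — t_in` of weight
`η` (`= 1/2` there). [cite: GrenetEtAl2011, Thm 5 (proof)] -/
def cornerBlock (ε η : R) : Matrix (Fin 3) (Fin 3) R := !![0, ε, η; ε, 0, 0; η, 0, 0]

/-- The border block: `s_out — v_in` of weight `a v` (the edges out of the source) and
`t_in — u_out` of weight `b u` (the edges into the sink); columns are the `in`-copies `⊕` the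
`out`-copies of the internal vertices. [cite: GrenetEtAl2011, Thm 5 (proof)] -/
def borderBlock (a b : V → R) : Matrix (Fin 3) (V ⊕ V) R :=
  Matrix.of ![(0 : V ⊕ V → R), Sum.elim a 0, Sum.elim 0 b]

/-- The middle block on the doubled internal vertices: `u_out — v_in` of weight `N u v` and the
links `u_in — u_out` of weight `1` (the graph `G_s` of GKKP, proof of Thm. 5).
[cite: GrenetEtAl2011, Thm 5 (proof)] -/
def midBlock (N : Matrix V V R) : Matrix (V ⊕ V) (V ⊕ V) R :=
  Matrix.fromBlocks 0 (1 + Nᵀ) (1 + N) 0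

/-- The symmetric matrix of an algebraic branching program with internal adjacency matrix `N`,
source weights `a`, sink weights `b` (= adjacency matrix of GKKP's graph `Ḡ`: vertices `c`,
`s_out`, `t_in`, `u_in`, `u_out`). [cite: GrenetEtAl2011, Thm 5 (proof)] -/
def symOfABP (N : Matrix V V R) (a b : V → R) (ε η : R) :
    Matrix (Fin 3 ⊕ (V ⊕ V)) (Fin 3 ⊕ (V ⊕ V)) R :=
  Matrix.fromBlocks (cornerBlock ε η) (borderBlock a b) (borderBlock a b)ᵀ (midBlock N)

omit [DecidableEq V] in
/-- The corner block is symmetric. [folklore] -/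
theorem isSymm_cornerBlock (ε η : R) : (cornerBlock (R := R) ε η).IsSymm := by
  refine Matrix.IsSymm.ext fun i j => ?_
  fin_cases i <;> fin_cases j <;> rfl

omit [Fintype V] in
/-- The middle block is symmetric. [folklore] -/
theorem isSymm_midBlock (N : Matrix V V R) : (midBlock N).IsSymm := by
  unfold midBlock
  refine Matrix.IsSymm.fromBlocks (by simp) ?_ (by simp)
  rw [transpose_add, transpose_one, transpose_transpose]

omit [Fintype V] in
/-- `symOfABP` is a symmetric matrix. [cite: GrenetEtAl2011, Thm 5 (proof)] -/
theorem isSymm_symOfABP (N : Matrix V V R) (a b : V → R) (ε η : R) :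
    (symOfABP N a b ε η).IsSymm := by
  unfold symOfABP
  exact Matrix.IsSymm.fromBlocks (isSymm_cornerBlock ε η) rfl (isSymm_midBlock N)

/-- The explicit inverse of the middle block built from an inverse `G` of `1 + N`. [folklore] -/
def midInv (G : Matrix V V R) : Matrix (V ⊕ V) (V ⊕ V) R :=
  Matrix.fromBlocks 0 G Gᵀ 0

/-- `midBlock N * midInv G = 1` when `(1 + N) G = 1`. [folklore] -/
theorem midBlock_mul_midInv (N G : Matrix V V R) (hG : (1 + N) * G = 1) :
    midBlock N * midInv G = 1 := by
  have hG' : G * (1 + N) = 1 := mul_eq_one_comm.1 hG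
  have hT : (1 + Nᵀ) * Gᵀ = 1 := by
    have h := congrArg transpose hG'
    rwa [transpose_mul, transpose_add, transpose_one] at h
  unfold midBlock midInv
  rw [fromBlocks_multiply]
  simp only [Matrix.zero_mul, Matrix.mul_zero, zero_add, add_zero, hG, hT, fromBlocks_one]

/-- `det (midBlock N) = (-1) ^ |V|` when `1 + N` has an inverse and determinant `1`. [folklore] -/
theorem det_midBlock (N G : Matrix V V R) (hG : (1 + N) * G = 1) (hdet : (1 + N).det = 1) :
    (midBlock N).det = (-1) ^ Fintype.card V := by
  have hG' : G * (1 + N) = 1 := mul_eq_one_comm.1 hG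
  have hfac : midBlock N =
      Matrix.fromBlocks 1 (-G) 0 1 * Matrix.fromBlocks 1 (1 + Nᵀ) (1 + N) 0 := by
    unfold midBlock
    rw [fromBlocks_multiply]
    simp only [Matrix.one_mul, Matrix.mul_zero, add_zero, Matrix.zero_mul, zero_add,
      Matrix.neg_mul, hG', add_neg_cancel]
  have hdetT : (1 + Nᵀ).det = 1 := by
    rw [← transpose_one, ← transpose_add, det_transpose, hdet]
  rw [hfac, det_mul, det_fromBlocks_zero₂₁, det_one, one_mul, one_mul,
    det_fromBlocks_one₁₁, zero_sub, ← neg_mul, det_mul, hdetT, mul_one, ← neg_one_smul R (1 + N),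
    det_smul, hdet, mul_one]

/-- The value of the branching program seen through the inverse `G` of `1 + N`:
`q = a · G · b`. [folklore] -/
def abpValue (G : Matrix V V R) (a b : V → R) : R := a ⬝ᵥ (G *ᵥ b)

omit [DecidableEq V] in
/-- Entries of a congruence `B M Bᵀ`. [folklore] -/
theorem mul_mul_transpose_apply {ι : Type*} (B : Matrix ι (V ⊕ V) R)
    (M : Matrix (V ⊕ V) (V ⊕ V) R) (i j : ι) :
    (B * M * Bᵀ) i j = ∑ x, ∑ y, B i x * M x y * B j y := by
  simp only [Matrix.mul_apply, Matrix.transpose_apply, Finset.sum_mul]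
  exact Finset.sum_comm

omit [DecidableEq V] in
/-- The congruence of the explicit inverse by the border block:
`B D⁻¹ Bᵀ = [[0, 0, 0], [0, 0, q], [0, q, 0]]` with `q = a G b`. [folklore] -/
theorem borderBlock_mul_midInv_mul_transpose (G : Matrix V V R) (a b : V → R) :
    borderBlock a b * midInv G * (borderBlock a b)ᵀ =
      !![0, 0, 0; 0, 0, abpValue G a b; 0, abpValue G a b, 0] := by
  have hq' : ∑ x : V, ∑ y : V, b x * G y x * a y = abpValue G a b := by
    unfold abpValue dotProduct mulVec dotProduct
    rw [Finset.sum_comm]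
    refine Finset.sum_congr rfl fun y _ => ?_
    rw [Finset.mul_sum]
    refine Finset.sum_congr rfl fun x _ => ?_
    ring
  have hq : ∑ x : V, ∑ y : V, a x * G x y * b y = abpValue G a b := by
    unfold abpValue dotProduct mulVec dotProduct
    refine Finset.sum_congr rfl fun x _ => ?_
    rw [Finset.mul_sum]
    refine Finset.sum_congr rfl fun y _ => ?_
    ring
  ext i j
  rw [mul_mul_transpose_apply]
  fin_cases i <;> fin_cases j <;>
    simp [borderBlock, midInv, Fintype.sum_sum_type, hq, hq']

omit [DecidableEq V] in
/-- The Schur complement of the middle block: `E − B D⁻¹ Bᵀ = [[0, ε, η], [ε, 0, −q], [η, −q, 0]]`.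
[cite: GrenetEtAl2011, Thm 5 (proof)] -/
theorem schur_symOfABP (G : Matrix V V R) (a b : V → R) (ε η : R) :
    cornerBlock ε η - borderBlock a b * midInv G * (borderBlock a b)ᵀ =
      !![0, ε, η; ε, 0, -abpValue G a b; η, -abpValue G a b, 0] := by
  rw [borderBlock_mul_midInv_mul_transpose, cornerBlock]
  ext i j
  fin_cases i <;> fin_cases j <;> simp

/-- **Determinant of the symmetrized branching program** (the algebraic content of GKKP's proof of
Thm. 5, there by counting cycle covers): if `(1 + N) G = 1` and `det (1 + N) = 1`, then
`det (symOfABP N a b ε η) = (-1)^{|V|} · (−2 ε η · a G b)`. [cite: GrenetEtAl2011, Thm 5 (proof)] -/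
theorem det_symOfABP (N G : Matrix V V R) (hG : (1 + N) * G = 1) (hdet : (1 + N).det = 1)
    (a b : V → R) (ε η : R) :
    (symOfABP N a b ε η).det =
      (-1) ^ Fintype.card V * -(2 * ε * η * abpValue G a b) := by
  letI : Invertible (midBlock N) := invertibleOfRightInverse _ _ (midBlock_mul_midInv N G hG)
  have hinv : ⅟(midBlock N) = midInv G := invOf_eq_right_inv (midBlock_mul_midInv N G hG)
  unfold symOfABP
  rw [det_fromBlocks₂₂, hinv, det_midBlock N G hG hdet, schur_symOfABP, det_fin_three]
  simp
  ring

end Symmetrization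

/-! ### Layered adjacency matrices: nilpotency and unipotency -/

section Layered

variable {V : Type*} [Fintype V] [DecidableEq V] {R : Type*} [CommRing R]

/-- `N` is *layered* by `ℓ : V → ℕ`: every edge (nonzero entry `N u v`) goes from a layer to the
next one — the layer structure of the Mahajan–Vinay branching program used in GKKP's proof of
Thm. 5 ("Every edge is from a layer `i` to a layer `i+1`"). [cite: GrenetEtAl2011, Thm 5 (proof)] -/
def IsLayered (N : Matrix V V R) (ℓ : V → ℕ) : Prop :=
  ∀ u v, N u v ≠ 0 → ℓ v = ℓ u + 1

variable {N : Matrix V V R} {ℓ : V → ℕ}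

/-- Paths of length `j` climb `j` layers. [folklore] -/
theorem IsLayered.pow_apply_ne_zero (h : IsLayered N ℓ) :
    ∀ (j : ℕ) (u v : V), (N ^ j) u v ≠ 0 → ℓ v = ℓ u + j := by
  intro j
  induction j with
  | zero =>
    intro u v huv
    rw [pow_zero] at huv
    by_cases h' : u = v
    · subst h'; simp
    · exact absurd (Matrix.one_apply_ne h') huv
  | succ j ih =>
    intro u v huv
    rw [pow_succ, Matrix.mul_apply] at huv
    obtain ⟨w, -, hw⟩ := Finset.exists_ne_zero_of_sum_ne_zero huv
    have h1 : (N ^ j) u w ≠ 0 := fun h0 => hw (by rw [h0, zero_mul])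
    have h2 : N w v ≠ 0 := fun h0 => hw (by rw [h0, mul_zero])
    rw [h w v h2, ih u w h1, add_assoc]

/-- A layered matrix with layers `≤ B` satisfies `N ^ (B + 1) = 0`. [folklore] -/
theorem IsLayered.pow_eq_zero (h : IsLayered N ℓ) {B : ℕ} (hB : ∀ v, ℓ v ≤ B) :
    N ^ (B + 1) = 0 := by
  ext u v
  by_contra hne
  have h1 := h.pow_apply_ne_zero (B + 1) u v hne
  have h2 := hB v
  omega

/-- A layered matrix is unipotent: `det (1 + N) = 1` (`1 + N` is block upper triangular for the
layers, with identity diagonal blocks). [folklore] -/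
theorem IsLayered.det_one_add (h : IsLayered N ℓ) : (1 + N).det = 1 := by
  have hbt : (1 + N).BlockTriangular ℓ := by
    intro i j hij
    have hne : i ≠ j := fun hij' => by subst hij'; exact lt_irrefl _ hij
    have hN : N i j = 0 := by
      by_contra h0
      have := h i j h0
      omega
    rw [Matrix.add_apply, Matrix.one_apply_ne hne, hN, add_zero]
  rw [hbt.det]
  refine Finset.prod_eq_one fun k _ => ?_
  have hblk : (1 + N).toSquareBlock ℓ k = 1 := by
    ext ⟨i, hi⟩ ⟨j, hj⟩
    rw [toSquareBlock_def, Matrix.of_apply, Matrix.add_apply]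
    have hN : N i j = 0 := by
      by_contra h0
      have := h i j h0
      omega
    by_cases hij : i = j
    · subst hij
      simp [hN]
    · rw [Matrix.one_apply_ne hij, hN, add_zero, Matrix.one_apply_ne]
      exact fun h' => hij (congrArg Subtype.val h')
  rw [hblk, det_one]

/-- The geometric-series inverse `∑_{j<m} (-N)^j` of `1 + N`. [folklore] -/
def geomInv (N : Matrix V V R) (m : ℕ) : Matrix V V R := ∑ j ∈ range m, (-N) ^ j

/-- `(1 + N) · ∑_{j<m} (-N)^j = 1` when `N ^ m = 0`. [folklore] -/
theorem one_add_mul_geomInv {m : ℕ} (hN : N ^ m = 0) : (1 + N) * geomInv N m = 1 := by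
  have h := mul_neg_geom_sum (-N) m
  rw [sub_neg_eq_add, neg_pow, hN, mul_zero, sub_zero] at h
  exact h

end Layered


/-! ## Part B. The branching program for the determinant -/

section PartB

variable (k : Type u) [CommRing k] (n : ℕ)


/-! ### The graded coefficients of the characteristic polynomials of the leading blocks -/

/-- `e t d` = the coefficient of `X^{t-d}` in `χ(M_t)`, `M_t = (X_{ij})_{i,j<t}` the leading block
of the generic matrix (the degree-`d` part; `0` for `d > t`): the signed weighted number of clow
sequences of total length `d` on the vertices `< t` (Mahajan–Vinay 1997, §3; Soltys 2002, §3).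
[cite: MahajanVinay1997, §3] -/
def e (t d : ℕ) : MvPolynomial (Fin n × Fin n) k :=
  if d ≤ t then (chi k n t).coeff (t - d) else 0

/-- `rowPow t q u = (R_t M_t^q)_u = ∑_j X_{t j} (M_t^q)_{j u}` (`0` for `u ≥ t`): the weight of the
partial clows with head `t` from `t` to `u` with `q + 1` edges (Soltys 2002, §3).
[cite: Soltys2002, §3] -/
def rowPow (t q u : ℕ) : MvPolynomial (Fin n × Fin n) k :=
  if h : u < t then ∑ j : Fin t, xvar k n t j * (genBlock k n t ^ q) j ⟨u, h⟩ else 0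

variable {k n}

/-- `e t 0 = 1` (`χ` is monic). [folklore] -/
theorem e_zero_right (t : ℕ) : e k n t 0 = 1 := by
  nontriviality MvPolynomial (Fin n × Fin n) k
  unfold e chi
  rw [if_pos (Nat.zero_le t), Nat.sub_zero]
  have h := (Matrix.charpoly_monic (genBlock k n t)).coeff_natDegree
  rwa [Matrix.charpoly_natDegree_eq_dim, Fintype.card_fin] at h

/-- `e 0 d = [d = 0]`. [folklore] -/
theorem e_zero_left (d : ℕ) : e k n 0 d = if d = 0 then 1 else 0 := by
  unfold e
  rw [chi_zero]
  by_cases hd : d = 0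
  · subst hd; simp
  · rw [if_neg (by omega), if_neg hd]

/-- `e t d = 0` for `d > t`. [folklore] -/
theorem e_of_lt {t d : ℕ} (h : t < d) : e k n t d = 0 := by
  unfold e
  rw [if_neg (by omega)]

/-- `rowPow t 0 u = X_{t u}` for `u < t`. [folklore] -/
theorem rowPow_zero {t u : ℕ} (hu : u < t) : rowPow k n t 0 u = xvar k n t u := by
  unfold rowPow
  rw [dif_pos hu, pow_zero]
  simp only [Matrix.one_apply, mul_ite, mul_one, mul_zero]
  rw [Finset.sum_ite_eq']
  simp

/-- `rowPow t (q+1) u = ∑_{w<t} rowPow t q w · X_{w u}` for `u < t`. [folklore] -/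
theorem rowPow_succ (t q : ℕ) {u : ℕ} (hu : u < t) :
    rowPow k n t (q + 1) u = ∑ w : Fin t, rowPow k n t q w * xvar k n w u := by
  unfold rowPow
  rw [dif_pos hu]
  simp only [Fin.is_lt, dif_pos, Fin.eta, pow_succ, Matrix.mul_apply, genBlock_apply,
    Finset.mul_sum, Finset.sum_mul]
  rw [Finset.sum_comm]
  refine Finset.sum_congr rfl fun w _ => Finset.sum_congr rfl fun j _ => ?_
  ring

/-- `berkNum t q = R_t M_t^q S_t = ∑_{w<t} rowPow t q w · X_{w t}`. [cite: Soltys2002, §2 Def. 2] -/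
theorem berkNum_eq_sum_rowPow (t q : ℕ) :
    berkNum k n t q = ∑ w : Fin t, rowPow k n t q w * xvar k n w t := by
  unfold berkNum rowPow
  simp only [Fin.is_lt, dif_pos, Fin.eta, Finset.sum_mul]
  exact Finset.sum_comm

/-- **Cayley–Hamilton makes long clows cancel**: for `c ≥ t`,
`∑_{d' ≤ t} [X^{t-d'}] χ(M_t) · M_t^{c-d'} = M_t^{c-t} · χ(M_t)(M_t) = 0`. [folklore] -/
theorem sum_coeff_smul_pow_eq_zero (t : ℕ) {c : ℕ} (hc : t ≤ c) :
    ∑ d' ∈ range (t + 1), (chi k n t).coeff (t - d') • genBlock k n t ^ (c - d') = 0 := by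
  nontriviality MvPolynomial (Fin n × Fin n) k
  have hdeg : (chi k n t).natDegree < t + 1 := by
    unfold chi
    rw [Matrix.charpoly_natDegree_eq_dim, Fintype.card_fin]
    exact Nat.lt_succ_self t
  have hCH : ∑ p ∈ range (t + 1), (chi k n t).coeff p • genBlock k n t ^ p = 0 := by
    rw [← Polynomial.aeval_eq_sum_range' hdeg]
    exact Matrix.aeval_self_charpoly _
  have hrefl := Finset.sum_range_reflect
    (fun p => (chi k n t).coeff p • genBlock k n t ^ (c - t + p)) (t + 1)
  simp only [Nat.add_sub_cancel] at hrefl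
  have h1 : ∀ d' ∈ range (t + 1), (chi k n t).coeff (t - d') • genBlock k n t ^ (c - d') =
      (chi k n t).coeff (t - d') • genBlock k n t ^ (c - t + (t - d')) := by
    intro d' hd'
    have : c - d' = c - t + (t - d') := by have := mem_range.1 hd'; omega
    rw [this]
  rw [Finset.sum_congr rfl h1, hrefl]
  have h2 : ∀ p ∈ range (t + 1), (chi k n t).coeff p • genBlock k n t ^ (c - t + p) =
      genBlock k n t ^ (c - t) * ((chi k n t).coeff p • genBlock k n t ^ p) := by
    intro p _
    rw [pow_add, Matrix.mul_smul]
  rw [Finset.sum_congr rfl h2, ← Finset.mul_sum, hCH, Matrix.mul_zero]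

/-- Scalar form: for `c ≥ t`, `∑_{d' ≤ t} e t d' · (R_t M_t^{c-d'} S_t) = 0`. [folklore] -/
theorem sum_e_mul_berkNum_eq_zero (t : ℕ) {c : ℕ} (hc : t ≤ c) :
    ∑ d' ∈ range (t + 1), e k n t d' * berkNum k n t (c - d') = 0 := by
  have hmat := sum_coeff_smul_pow_eq_zero (k := k) (n := n) t hc
  have h1 : ∀ d' ∈ range (t + 1), e k n t d' * berkNum k n t (c - d') =
      ∑ j : Fin t, ∑ i : Fin t, xvar k n t j *
        (((chi k n t).coeff (t - d') • genBlock k n t ^ (c - d')) j i) * xvar k n i t := by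
    intro d' hd'
    unfold e berkNum
    rw [if_pos (Nat.lt_succ_iff.1 (mem_range.1 hd')), Finset.mul_sum]
    refine Finset.sum_congr rfl fun j _ => ?_
    rw [Finset.mul_sum]
    refine Finset.sum_congr rfl fun i _ => ?_
    rw [Matrix.smul_apply, smul_eq_mul]
    ring
  rw [Finset.sum_congr rfl h1, Finset.sum_comm]
  refine Finset.sum_eq_zero fun j _ => ?_
  rw [Finset.sum_comm]
  refine Finset.sum_eq_zero fun i _ => ?_
  have hij := congrFun (congrFun hmat j) i
  rw [Matrix.sum_apply, Matrix.zero_apply] at hij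
  rw [← Finset.sum_mul, ← Finset.mul_sum, hij, mul_zero, zero_mul]

/-- **Berkowitz's recursion in graded form, for all degrees**:
`e (t+1) (d+1) = e t (d+1) − X_{tt} · e t d − ∑_{d'<d} e t d' · R_t M_t^{d-1-d'} S_t`; for `d ≤ t`
this is `chi_succ_coeff`, for `d > t` both sides vanish by Cayley–Hamilton.
[cite: Soltys2002, §2 Def. 2] -/
theorem e_succ (t d : ℕ) :
    e k n (t + 1) (d + 1) = e k n t (d + 1) - xvar k n t t * e k n t d -
      ∑ d' ∈ range d, e k n t d' * berkNum k n t (d - 1 - d') := by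
  by_cases hd : d ≤ t
  · have hl := chi_succ_coeff (k := k) (n := n) t (t - d)
    have hL : e k n (t + 1) (d + 1) = (chi k n (t + 1)).coeff (t - d) := by
      unfold e; rw [if_pos (by omega), Nat.add_sub_add_right]
    have h1 : e k n t (d + 1) = if t - d = 0 then 0 else (chi k n t).coeff (t - d - 1) := by
      unfold e
      by_cases h : d + 1 ≤ t
      · rw [if_pos h, if_neg (by omega)]
        rfl
      · rw [if_neg h, if_pos (by omega)]
    have h2 : e k n t d = (chi k n t).coeff (t - d) := by unfold e; rw [if_pos hd]
    have h3 : ∑ d' ∈ range d, e k n t d' * berkNum k n t (d - 1 - d') =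
        ∑ p ∈ Ioc (t - d) t, (chi k n t).coeff p * berkNum k n t (p - (t - d + 1)) := by
      refine Finset.sum_nbij' (fun d' => t - d') (fun p => t - p) ?_ ?_ ?_ ?_ ?_
      · intro d' hd'; have := mem_range.1 hd'; simp only [mem_Ioc]; omega
      · intro p hp; have := mem_Ioc.1 hp; simp only [mem_range]; omega
      · intro d' hd'; have := mem_range.1 hd'; omega
      · intro p hp; have := mem_Ioc.1 hp; omega
      · intro d' hd'
        have h' := mem_range.1 hd'
        unfold e
        rw [if_pos (by omega)]
        congr 2
        omega
    rw [hL, hl, h1, h2, h3]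
  · rw [not_le] at hd
    rw [e_of_lt (by omega), e_of_lt (by omega), e_of_lt hd, mul_zero, sub_zero, zero_sub, eq_comm,
      neg_eq_zero]
    have hsplit : range d = range (t + 1) ∪ Ico (t + 1) d := by
      rw [Finset.range_eq_Ico, Finset.range_eq_Ico,
        Finset.Ico_union_Ico_eq_Ico (Nat.zero_le _) (by omega)]
    rw [hsplit, Finset.sum_union]
    · have h0 : ∑ d' ∈ Ico (t + 1) d, e k n t d' * berkNum k n t (d - 1 - d') = 0 :=
        Finset.sum_eq_zero fun d' hd' => by
          rw [e_of_lt (by have := (mem_Ico.1 hd').1; omega), zero_mul]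
      rw [h0, add_zero]
      exact sum_e_mul_berkNum_eq_zero t (by omega)
    · rw [Finset.range_eq_Ico]
      exact Finset.Ico_disjoint_Ico_consecutive 0 (t + 1) d

/-! ### The signed clow dynamics (Mahajan–Vinay's branching program, Berkowitz orientation)

States are pairs `(t, u)` of naturals: `u < t` means "inside a clow with head `t`, currently at the
vertex `u`" (heads are the LARGEST vertex of their clow here, as in Berkowitz/Soltys; Mahajan–Vinay
take the least), `u = t` means "a clow with head `t` has just been closed", `u > t` is unused.
Heads increase along a clow sequence. -/

section Dynamics

variable (k n)

/-- The weight of one edge of the branching program from the vertex `f` into the state `(t', u')`: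
continue the current clow (head `t'`) to a vertex `u' < t'` — weight `X_{f u'}` — or close it at
its head, `u' = t'` — weight `−X_{f t'}`, the sign `−1` of a completed clow (Mahajan–Vinay 1997,
§3: `sgn = (-1)^{n + #clows}`). [cite: MahajanVinay1997, §3] -/
def stepW (f t' u' : ℕ) : MvPolynomial (Fin n × Fin n) k :=
  if u' < t' then xvar k n f u' else if u' = t' then -xvar k n f t' else 0

/-- One layer of the dynamics: the new value at the state `(t, u)` collects the states `(t, w)`,
`w < t`, of the previous layer (continue/close the clow with head `t`) and the *boundary mass*
`B t` (open a new clow with head `t`: its first edge leaves `t`). [cite: MahajanVinay1997, §3] -/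
def stepOp (prev : ℕ → ℕ → MvPolynomial (Fin n × Fin n) k)
    (B : ℕ → MvPolynomial (Fin n × Fin n) k) (t u : ℕ) : MvPolynomial (Fin n × Fin n) k :=
  (∑ w ∈ range t, prev t w * stepW k n w t u) + B t * stepW k n t t u

/-- The boundary mass at head `t`: the source (at layer `0`) plus all closed clows with a smaller
head. [cite: MahajanVinay1997, §3] -/
def bmass (prev : ℕ → ℕ → MvPolynomial (Fin n × Fin n) k) (d t : ℕ) :
    MvPolynomial (Fin n × Fin n) k :=
  (if d = 0 then 1 else 0) + ∑ t' ∈ range t, prev t' t'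

/-- **The signed clow dynamics** `sv d t u`: the signed weighted number of partial clow sequences
with `d` edges ending in the state `(t, u)` (Mahajan–Vinay 1997, §3, the branching program for the
determinant, in Berkowitz's orientation). [cite: MahajanVinay1997, §3] -/
def sv : ℕ → ℕ → ℕ → MvPolynomial (Fin n × Fin n) k
  | 0 => fun _ _ => 0
  | d + 1 => stepOp k n (sv d) (bmass k n (sv d) d)

variable {k n}

/-- Unfolding one layer. [folklore] -/
theorem sv_succ (d t u : ℕ) :
    sv k n (d + 1) t u = stepOp k n (sv k n d) (bmass k n (sv k n d) d) t u := rfl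

/-- **The invariants of the dynamics** (the algebraic form of Mahajan–Vinay's correctness proof,
here via Berkowitz's recursion `e_succ`): inside a clow the value is
`∑_{d'<d} e t d' · (R_t M_t^{d-1-d'})_u`, at a closed head it is `e (t+1) d − e t d`, and unused
states carry `0`. [cite: MahajanVinay1997, §3 Thm 2] -/
theorem sv_spec (d : ℕ) :
    (∀ t u, u < t → sv k n d t u = ∑ d' ∈ range d, e k n t d' * rowPow k n t (d - 1 - d') u) ∧
    (∀ t, sv k n d t t = e k n (t + 1) d - e k n t d) ∧
    (∀ t u, t < u → sv k n d t u = 0) := by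
  induction d with
  | zero =>
    refine ⟨fun t u _ => ?_, fun t => ?_, fun t u _ => ?_⟩
    · simp [sv]
    · simp [sv, e_zero_right]
    · simp [sv]
  | succ d ih =>
    obtain ⟨hin, hbd, hjunk⟩ := ih
    have hB : ∀ t, bmass k n (sv k n d) d t = e k n t d := by
      intro t
      unfold bmass
      simp_rw [hbd]
      rw [Finset.sum_range_sub (fun t' => e k n t' d), e_zero_left]
      split_ifs <;> ring
    refine ⟨fun t u hu => ?_, fun t => ?_, fun t u hu => ?_⟩
    · -- inside a clow
      rw [sv_succ, stepOp, hB, Finset.sum_range_succ, Nat.add_sub_cancel, Nat.sub_self,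
        rowPow_zero hu]
      have hsw : ∀ w, stepW k n w t u = xvar k n w u := fun w => by
        unfold stepW; rw [if_pos hu]
      simp_rw [hsw]
      congr 1
      have h1 : ∀ w ∈ range t, sv k n d t w * xvar k n w u =
          ∑ d' ∈ range d, e k n t d' * (rowPow k n t (d - 1 - d') w * xvar k n w u) := by
        intro w hw
        rw [hin t w (mem_range.1 hw), Finset.sum_mul]
        refine Finset.sum_congr rfl fun d' _ => ?_
        ring
      rw [Finset.sum_congr rfl h1, Finset.sum_comm]
      refine Finset.sum_congr rfl fun d' hd' => ?_
      have hd'' := mem_range.1 hd'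
      rw [← Finset.mul_sum, show d - d' = (d - 1 - d') + 1 by omega, rowPow_succ _ _ hu,
        Fin.sum_univ_eq_sum_range (fun w => rowPow k n t (d - 1 - d') w * xvar k n w u) t]
    · -- a closed head
      rw [sv_succ, stepOp, hB, e_succ]
      have hsw : ∀ w, stepW k n w t t = -xvar k n w t := fun w => by
        unfold stepW; rw [if_neg (lt_irrefl t), if_pos rfl]
      simp_rw [hsw]
      have h1 : ∀ w ∈ range t, sv k n d t w * -xvar k n w t =
          -∑ d' ∈ range d, e k n t d' * (rowPow k n t (d - 1 - d') w * xvar k n w t) := by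
        intro w hw
        rw [hin t w (mem_range.1 hw), mul_neg, Finset.sum_mul]
        refine congrArg Neg.neg (Finset.sum_congr rfl fun d' _ => ?_)
        ring
      rw [Finset.sum_congr rfl h1, Finset.sum_neg_distrib, Finset.sum_comm]
      have h2 : ∀ d' ∈ range d, ∑ w ∈ range t, e k n t d' * (rowPow k n t (d - 1 - d') w *
          xvar k n w t) = e k n t d' * berkNum k n t (d - 1 - d') := by
        intro d' _
        rw [← Finset.mul_sum, berkNum_eq_sum_rowPow,
          Fin.sum_univ_eq_sum_range (fun w => rowPow k n t (d - 1 - d') w * xvar k n w t) t]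
      rw [Finset.sum_congr rfl h2]
      ring
    · -- unused states
      rw [sv_succ, stepOp]
      have hsw : ∀ w, stepW k n w t u = 0 := fun w => by
        unfold stepW; rw [if_neg (by omega), if_neg (by omega)]
      simp [hsw]

/-- The boundary mass at layer `d` and head `t` is `e t d` (telescoping). [cite: MahajanVinay1997, §3] -/
theorem bmass_sv (d t : ℕ) : bmass k n (sv k n d) d t = e k n t d := by
  unfold bmass
  simp_rw [(sv_spec (k := k) (n := n) d).2.1]
  rw [Finset.sum_range_sub (fun t' => e k n t' d), e_zero_left]
  split_ifs <;> ring

/-- **The value of the branching program**: after `n` edges the closed heads carry in total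
`[X^0] χ(M_n)` (minus the empty sequence when `n = 0`), i.e. `(-1)^n det` of the generic matrix
(Mahajan–Vinay 1997, §3, Thm. 2). [cite: MahajanVinay1997, §3 Thm 2] -/
theorem sum_sv_diag :
    ∑ t ∈ range n, sv k n n t t = (chi k n n).coeff 0 - if n = 0 then 1 else 0 := by
  simp_rw [(sv_spec (k := k) (n := n) n).2.1]
  rw [Finset.sum_range_sub (fun t' => e k n t' n), e_zero_left]
  unfold e
  rw [if_pos le_rfl, Nat.sub_self]

end Dynamics

/-! ### Transfer matrices: the signed one and its parity doubling -/

section Transfer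

variable (k n)

/-- The signed transfer matrix of one layer on the states `Fin n × Fin n`: from `(t, u)` with
`u < t` continue or close the clow with head `t`; from a closed head `(t, t)` open a clow with a
larger head `t'`. [cite: MahajanVinay1997, §3] -/
def T₀ : Matrix (Fin n × Fin n) (Fin n × Fin n) (MvPolynomial (Fin n × Fin n) k) :=
  Matrix.of fun σ σ' =>
    if (σ.2 : ℕ) < σ.1 then (if σ'.1 = σ.1 then stepW k n σ.2 σ'.1 σ'.2 else 0)
    else if σ.2 = σ.1 then (if (σ.1 : ℕ) < σ'.1 then stepW k n σ'.1 σ'.1 σ'.2 else 0)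
    else 0

/-- The signed weights of the edges out of the source (open the first clow, any head).
[cite: MahajanVinay1997, §3] -/
def start₀ : Fin n × Fin n → MvPolynomial (Fin n × Fin n) k :=
  fun σ' => stepW k n σ'.1 σ'.1 σ'.2

/-- The UNSIGNED weight of one edge with a parity bit recording the number of completed clows
mod `2` (closing a clow flips the bit) — so that every edge weight is a single variable, as in
GKKP's Thm. 5 ("entries in `{x_{i,j}} ∪ {0, 1, −1, 1/2}`"; Mahajan–Vinay's vertices `[p, h, u, i]`
carry the parity `p`). [cite: MahajanVinay1997, §3] -/
def stepWp (f t' u' : ℕ) (π π' : Bool) : MvPolynomial (Fin n × Fin n) k :=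
  if u' < t' then (if π' = π then xvar k n f u' else 0)
  else if u' = t' then (if π' = !π then xvar k n f t' else 0) else 0

/-- The parity-doubled (unsigned) transfer matrix on the `2n²` states `(Fin n × Fin n) × Bool` of
one layer of the branching program. [cite: MahajanVinay1997, §3] -/
def Tp : Matrix ((Fin n × Fin n) × Bool) ((Fin n × Fin n) × Bool)
    (MvPolynomial (Fin n × Fin n) k) :=
  Matrix.of fun s s' =>
    if (s.1.2 : ℕ) < s.1.1 then
      (if s'.1.1 = s.1.1 then stepWp k n s.1.2 s'.1.1 s'.1.2 s.2 s'.2 else 0)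
    else if s.1.2 = s.1.1 then
      (if (s.1.1 : ℕ) < s'.1.1 then stepWp k n s'.1.1 s'.1.1 s'.1.2 s.2 s'.2 else 0)
    else 0

/-- The unsigned weights of the edges out of the source (parity `false`). [cite: MahajanVinay1997, §3] -/
def startp : (Fin n × Fin n) × Bool → MvPolynomial (Fin n × Fin n) k :=
  fun s' => stepWp k n s'.1.1 s'.1.1 s'.1.2 false s'.2

/-- The sign `±1` of a parity. [folklore] -/
def sgnB (π : Bool) : MvPolynomial (Fin n × Fin n) k := if π then -1 else 1

/-- The signed collapse of a parity-indexed vector: `w(σ, even) − w(σ, odd)`. [folklore] -/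
def sg (w : (Fin n × Fin n) × Bool → MvPolynomial (Fin n × Fin n) k) :
    Fin n × Fin n → MvPolynomial (Fin n × Fin n) k :=
  fun σ => ∑ π : Bool, sgnB k n π * w (σ, π)

variable {k n}

/-- Sums over `Fin n` cut off below `t ≤ n` are sums over `range t`. [folklore] -/
theorem sum_fin_ite_lt {t : ℕ} (ht : t ≤ n) (f : ℕ → MvPolynomial (Fin n × Fin n) k) :
    ∑ u : Fin n, (if (u : ℕ) < t then f u else 0) = ∑ u ∈ range t, f u := by
  rw [Fin.sum_univ_eq_sum_range (fun u => if u < t then f u else 0) n, ← Finset.sum_filter]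
  refine Finset.sum_congr ?_ fun _ _ => rfl
  ext u
  simp only [Finset.mem_filter, Finset.mem_range]
  omega

/-- One layer of the signed transfer matrix is one step of the dynamics `sv` (from layer
`d ≥ 1`). [cite: MahajanVinay1997, §3] -/
theorem sv_vecMul_T₀ {d : ℕ} (hd : 1 ≤ d) :
    (fun σ : Fin n × Fin n => sv k n d σ.1 σ.2) ᵥ* T₀ k n =
      fun σ' => sv k n (d + 1) σ'.1 σ'.2 := by
  funext σ'
  obtain ⟨t', u'⟩ := σ'
  rw [sv_succ, stepOp, bmass, if_neg (by omega), zero_add]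
  simp only [Matrix.vecMul, dotProduct, Fintype.sum_prod_type]
  have hsplit : ∀ t u : Fin n, sv k n d t u * T₀ k n (t, u) (t', u') =
      (if t' = t then (if (u : ℕ) < t then sv k n d t u * stepW k n u t' u' else 0) else 0) +
        (if u = t then (if (t : ℕ) < t' then sv k n d t t * stepW k n t' t' u' else 0)
          else 0) := by
    intro t u
    simp only [T₀, Matrix.of_apply]
    by_cases h1 : (u : ℕ) < t
    · have h2 : u ≠ t := fun h => by subst h; exact lt_irrefl _ h1
      rw [if_pos h1, if_neg h2, add_zero]
      split_ifs <;> simp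
    · rw [if_neg h1]
      by_cases h2 : u = t
      · subst h2
        rw [if_pos rfl, if_pos rfl]
        split_ifs <;> simp
      · rw [if_neg h2, if_neg h2, mul_zero]
        split_ifs <;> simp
  simp_rw [hsplit, Finset.sum_add_distrib]
  congr 1
  · simp_rw [Finset.sum_ite_irrel, Finset.sum_const_zero]
    rw [Finset.sum_ite_eq, if_pos (Finset.mem_univ _)]
    exact sum_fin_ite_lt (Nat.le_of_lt t'.isLt) (fun u => sv k n d t' u * stepW k n u t' u')
  · simp_rw [Finset.sum_ite_eq' Finset.univ, if_pos (Finset.mem_univ _)]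
    rw [sum_fin_ite_lt (Nat.le_of_lt t'.isLt) (fun t => sv k n d t t * stepW k n t' t' u'),
      Finset.sum_mul]

/-- The source row is the first layer of the dynamics. [cite: MahajanVinay1997, §3] -/
theorem start₀_eq : start₀ k n = fun σ' : Fin n × Fin n => sv k n 1 σ'.1 σ'.2 := by
  funext σ'
  simp [start₀, sv, stepOp, bmass]

/-- Hence `start₀ · T₀^d` is the layer `d + 1` of the dynamics. [cite: MahajanVinay1997, §3] -/
theorem start₀_vecMul_pow (d : ℕ) :
    start₀ k n ᵥ* T₀ k n ^ d = fun σ' : Fin n × Fin n => sv k n (d + 1) σ'.1 σ'.2 := by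
  induction d with
  | zero => rw [pow_zero, Matrix.vecMul_one, start₀_eq]
  | succ d ih => rw [pow_succ, ← Matrix.vecMul_vecMul, ih, sv_vecMul_T₀ (by omega)]

/-- Signed collapse of one parity-doubled edge weight. [folklore] -/
theorem sum_sgnB_mul_stepWp (f t' u' : ℕ) (π : Bool) :
    ∑ π' : Bool, sgnB k n π' * stepWp k n f t' u' π π' = sgnB k n π * stepW k n f t' u' := by
  unfold stepWp stepW
  by_cases h1 : u' < t'
  · simp_rw [if_pos h1]
    simp [sgnB]
  · simp_rw [if_neg h1]
    by_cases h2 : u' = t'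
    · simp_rw [if_pos h2]
      cases π <;> simp [sgnB]
    · simp_rw [if_neg h2]
      simp

/-- Signed collapse of one row of the parity-doubled transfer matrix. [folklore] -/
theorem sum_sgnB_mul_Tp (s : (Fin n × Fin n) × Bool) (σ' : Fin n × Fin n) :
    ∑ π' : Bool, sgnB k n π' * Tp k n s (σ', π') = sgnB k n s.2 * T₀ k n s.1 σ' := by
  obtain ⟨⟨t, u⟩, π⟩ := s
  obtain ⟨t', u'⟩ := σ'
  simp only [Tp, T₀, Matrix.of_apply]
  by_cases h1 : (u : ℕ) < t
  · simp_rw [if_pos h1]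
    by_cases h2 : t' = t
    · simp_rw [if_pos h2]
      exact sum_sgnB_mul_stepWp _ _ _ _
    · simp_rw [if_neg h2]
      simp
  · simp_rw [if_neg h1]
    by_cases h2 : u = t
    · simp_rw [if_pos h2]
      by_cases h3 : (t : ℕ) < t'
      · simp_rw [if_pos h3]
        exact sum_sgnB_mul_stepWp _ _ _ _
      · simp_rw [if_neg h3]
        simp
    · simp_rw [if_neg h2]
      simp

/-- **The parity doubling is faithful**: collapsing signs after a layer of `Tp` is a layer of the
signed matrix `T₀` after collapsing signs. [cite: MahajanVinay1997, §3] -/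
theorem sg_vecMul_Tp (w : (Fin n × Fin n) × Bool → MvPolynomial (Fin n × Fin n) k) :
    sg k n (w ᵥ* Tp k n) = sg k n w ᵥ* T₀ k n := by
  funext σ'
  simp only [sg, Matrix.vecMul, dotProduct]
  have hR : ∑ σ : Fin n × Fin n, (∑ π : Bool, sgnB k n π * w (σ, π)) * T₀ k n σ σ' =
      ∑ s : (Fin n × Fin n) × Bool, sgnB k n s.2 * w s * T₀ k n s.1 σ' := by
    rw [Fintype.sum_prod_type (f := fun s : (Fin n × Fin n) × Bool =>
      sgnB k n s.2 * w s * T₀ k n s.1 σ')]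
    exact Finset.sum_congr rfl fun σ _ => Finset.sum_mul _ _ _
  have hL : ∑ π' : Bool, sgnB k n π' * ∑ s, w s * Tp k n s (σ', π') =
      ∑ s : (Fin n × Fin n) × Bool, sgnB k n s.2 * w s * T₀ k n s.1 σ' := by
    simp_rw [Finset.mul_sum]
    rw [Finset.sum_comm]
    refine Finset.sum_congr rfl fun s _ => ?_
    have h := sum_sgnB_mul_Tp (k := k) (n := n) s σ'
    calc ∑ π' : Bool, sgnB k n π' * (w s * Tp k n s (σ', π'))
        = w s * ∑ π' : Bool, sgnB k n π' * Tp k n s (σ', π') := by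
          rw [Finset.mul_sum]
          exact Finset.sum_congr rfl fun π' _ => by ring
      _ = w s * (sgnB k n s.2 * T₀ k n s.1 σ') := by rw [h]
      _ = _ := by ring
  rw [hL, hR]

/-- The source rows agree after collapsing signs. [folklore] -/
theorem sg_startp : sg k n (startp k n) = start₀ k n := by
  funext σ'
  simp only [sg, startp, start₀]
  rw [sum_sgnB_mul_stepWp]
  simp [sgnB]

/-- Hence the signed collapse of `startp · Tp^d` is the layer `d + 1` of the signed dynamics.
[cite: MahajanVinay1997, §3] -/
theorem sg_startp_vecMul_pow (d : ℕ) :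
    sg k n (startp k n ᵥ* Tp k n ^ d) = fun σ' : Fin n × Fin n => sv k n (d + 1) σ'.1 σ'.2 := by
  rw [← start₀_vecMul_pow]
  induction d with
  | zero => rw [pow_zero, pow_zero, Matrix.vecMul_one, Matrix.vecMul_one, sg_startp]
  | succ d ih =>
    rw [pow_succ, pow_succ, ← Matrix.vecMul_vecMul, ← Matrix.vecMul_vecMul, sg_vecMul_Tp, ih]

end Transfer


/-! ### The whole branching program: `n` layers of the `2n²` states and the two pre-sinks -/

section Program

variable (k n)

/-- The internal vertices of the branching program: `n` layers (layer `i : Fin n` is reached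
after `i + 1` edges) of the `2n²` states `(Fin n × Fin n) × Bool`, and the two pre-sinks
`t₊ = inr false`, `t₋ = inr true` (GKKP, proof of Thm. 5: "this graph has `2n³+3` vertices … the
last layer being `{t₊, t₋}`"; here `|Vtx| = 2n³ + 2`, the source and the sink being the border
vertices `s_out`, `t_in` of `symOfABP`). [cite: GrenetEtAl2011, Thm 5 (proof)] -/
abbrev Vtx : Type := (Fin n × ((Fin n × Fin n) × Bool)) ⊕ Bool

/-- The internal adjacency matrix: layer `i` to layer `i + 1` by the parity-doubled transfer
matrix, and from the closed heads of the last layer to the pre-sink of their parity (weight `1`).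
[cite: GrenetEtAl2011, Thm 5 (proof)] -/
def bigN : Matrix (Vtx n) (Vtx n) (MvPolynomial (Fin n × Fin n) k) :=
  Matrix.of fun v v' =>
    match v, v' with
    | Sum.inl p, Sum.inl p' => if (p'.1 : ℕ) = p.1 + 1 then Tp k n p.2 p'.2 else 0
    | Sum.inl p, Sum.inr π' =>
        if (p.1 : ℕ) + 1 = n ∧ p.2.1.2 = p.2.1.1 ∧ p.2.2 = π' then 1 else 0
    | Sum.inr _, _ => 0

/-- The weights of the edges out of the source: into layer `0`, opening the first clow.
[cite: GrenetEtAl2011, Thm 5 (proof)] -/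
def srcVec : Vtx n → MvPolynomial (Fin n × Fin n) k :=
  Sum.elim (fun p => if (p.1 : ℕ) = 0 then startp k n p.2 else 0) 0

/-- The weights of the edges into the sink: `+1` from `t₊`, `−1` from `t₋` (GKKP: "add a vertex
`t`, an edge `(t₊, t)` of weight `1` and an edge `(t₋, t)` of weight `−1`").
[cite: GrenetEtAl2011, Thm 5 (proof)] -/
def snkVec : Vtx n → MvPolynomial (Fin n × Fin n) k :=
  Sum.elim 0 (sgnB k n)

/-- The layer of an internal vertex. [cite: GrenetEtAl2011, Thm 5 (proof)] -/
def layerFn : Vtx n → ℕ := Sum.elim (fun p => (p.1 : ℕ)) (fun _ => n)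

/-- A vector supported on layer `d`. [folklore] -/
def layerVec (d : ℕ) (w : (Fin n × Fin n) × Bool → MvPolynomial (Fin n × Fin n) k) :
    Vtx n → MvPolynomial (Fin n × Fin n) k :=
  Sum.elim (fun p => if (p.1 : ℕ) = d then w p.2 else 0) 0

/-- A vector supported on the pre-sinks: the closed heads of `w`, sorted by parity. [folklore] -/
def finVec (w : (Fin n × Fin n) × Bool → MvPolynomial (Fin n × Fin n) k) :
    Vtx n → MvPolynomial (Fin n × Fin n) k :=
  Sum.elim 0 fun π' => ∑ s : (Fin n × Fin n) × Bool,
    w s * (if s.1.2 = s.1.1 ∧ s.2 = π' then 1 else 0)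

variable {k n}

/-- Entries of `bigN` between two layers. [folklore] -/
@[simp] theorem bigN_inl_inl (p p' : Fin n × ((Fin n × Fin n) × Bool)) :
    bigN k n (Sum.inl p) (Sum.inl p') = if (p'.1 : ℕ) = p.1 + 1 then Tp k n p.2 p'.2 else 0 :=
  rfl

/-- Entries of `bigN` from a layer to a pre-sink. [folklore] -/
@[simp] theorem bigN_inl_inr (p : Fin n × ((Fin n × Fin n) × Bool)) (π' : Bool) :
    bigN k n (Sum.inl p) (Sum.inr π') =
      if (p.1 : ℕ) + 1 = n ∧ p.2.1.2 = p.2.1.1 ∧ p.2.2 = π' then 1 else 0 :=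
  rfl

/-- The pre-sinks have no outgoing internal edges. [folklore] -/
@[simp] theorem bigN_inr (π : Bool) (v' : Vtx n) : bigN k n (Sum.inr π) v' = 0 := by
  cases v' <;> rfl

/-- `bigN` is layered by `layerFn`. [cite: GrenetEtAl2011, Thm 5 (proof)] -/
theorem bigN_isLayered : IsLayered (bigN k n) (layerFn n) := by
  rintro (p | π) (p' | π') h
  · simp only [bigN_inl_inl, ne_eq, ite_eq_right_iff, Classical.not_imp] at h
    simpa [layerFn] using h.1
  · simp only [bigN_inl_inr, ne_eq, ite_eq_right_iff, Classical.not_imp] at h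
    simp only [layerFn, Sum.elim_inr, Sum.elim_inl]
    exact h.1.1.symm
  · simp at h
  · simp at h

/-- Layers are `≤ n`. [folklore] -/
theorem layerFn_le (v : Vtx n) : layerFn n v ≤ n := by
  rcases v with p | π
  · exact Nat.le_of_lt p.1.isLt
  · exact le_rfl

/-- Hence `bigN ^ (n + 1) = 0`. [folklore] -/
theorem bigN_pow_eq_zero : bigN k n ^ (n + 1) = 0 :=
  (bigN_isLayered (k := k) (n := n)).pow_eq_zero (layerFn_le (n := n))

/-- … and `det (1 + bigN) = 1`. [folklore] -/
theorem det_one_add_bigN : (1 + bigN k n).det = 1 :=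
  (bigN_isLayered (k := k) (n := n)).det_one_add

/-- Exactly one index of `Fin n` has value `d` when `d < n`, none otherwise. [folklore] -/
theorem sum_fin_val_eq (d : ℕ) (c : MvPolynomial (Fin n × Fin n) k) :
    ∑ i : Fin n, (if (i : ℕ) = d then c else 0) = if d < n then c else 0 := by
  by_cases hd : d < n
  · rw [if_pos hd]
    have h : ∀ i : Fin n, ((i : ℕ) = d) = (i = ⟨d, hd⟩) := fun i => by
      rw [Fin.ext_iff]
    simp_rw [h]
    rw [Finset.sum_ite_eq', if_pos (Finset.mem_univ _)]
  · rw [if_neg hd]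
    exact Finset.sum_eq_zero fun i _ => if_neg (by have := i.isLt; omega)

/-- **Layer propagation**: a vector on layer `d` is sent by `bigN` to `w · Tp` on layer `d + 1`,
plus — from the last layer — its closed heads onto the pre-sinks. [cite: GrenetEtAl2011, Thm 5 (proof)] -/
theorem layerVec_vecMul (d : ℕ) (w : (Fin n × Fin n) × Bool → MvPolynomial (Fin n × Fin n) k) :
    layerVec k n d w ᵥ* bigN k n =
      layerVec k n (d + 1) (w ᵥ* Tp k n) + if d + 1 = n then finVec k n w else 0 := by
  funext v
  rw [Pi.add_apply]
  simp only [Matrix.vecMul, dotProduct, Fintype.sum_sum_type, layerVec, Sum.elim_inr,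
    Pi.zero_apply, zero_mul, Finset.sum_const_zero, add_zero, Sum.elim_inl]
  cases v with
  | inl p' =>
    obtain ⟨i', s'⟩ := p'
    have h0 : (if d + 1 = n then finVec k n w else 0) (Sum.inl (i', s')) = 0 := by
      split_ifs <;> simp [finVec]
    rw [h0, add_zero, Sum.elim_inl, Fintype.sum_prod_type]
    simp only [bigN_inl_inl]
    have h1 : ∀ i : Fin n, ∑ s : (Fin n × Fin n) × Bool, (if (i : ℕ) = d then w s else 0) *
        (if (i' : ℕ) = i + 1 then Tp k n s s' else 0) =
          if (i : ℕ) = d then (if (i' : ℕ) = d + 1 then ∑ s, w s * Tp k n s s' else 0)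
          else 0 := by
      intro i
      by_cases hi : (i : ℕ) = d
      · simp_rw [if_pos hi]
        rw [← hi]
        by_cases h' : (i' : ℕ) = i + 1
        · simp_rw [if_pos h']
        · simp_rw [if_neg h']
          simp
      · simp_rw [if_neg hi]
        simp
    rw [Finset.sum_congr rfl fun i _ => h1 i, sum_fin_val_eq]
    by_cases hd : d < n
    · rw [if_pos hd]
    · rw [if_neg hd, if_neg (by have := i'.isLt; omega)]
  | inr π' =>
    rw [Sum.elim_inr, Pi.zero_apply, zero_add, Fintype.sum_prod_type]
    simp only [bigN_inl_inr]
    have h1 : ∀ i : Fin n, ∑ s : (Fin n × Fin n) × Bool, (if (i : ℕ) = d then w s else 0) *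
        (if (i : ℕ) + 1 = n ∧ s.1.2 = s.1.1 ∧ s.2 = π' then 1 else 0) =
          if (i : ℕ) = d then (if d + 1 = n then
            ∑ s : (Fin n × Fin n) × Bool, w s * (if s.1.2 = s.1.1 ∧ s.2 = π' then 1 else 0)
            else 0) else 0 := by
      intro i
      by_cases hi : (i : ℕ) = d
      · simp_rw [if_pos hi]
        rw [← hi]
        by_cases h' : (i : ℕ) + 1 = n
        · simp_rw [if_pos h']
          simp [h']
        · simp_rw [if_neg h']
          simp [h']
      · simp_rw [if_neg hi]
        simp
    rw [Finset.sum_congr rfl fun i _ => h1 i, sum_fin_val_eq]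
    by_cases hd : d + 1 = n
    · rw [if_pos (by omega), if_pos hd, if_pos hd]
      simp [finVec]
    · rw [if_neg hd]
      split_ifs <;> simp

/-- The pre-sinks have no outgoing internal edges. [folklore] -/
theorem finVec_vecMul (w : (Fin n × Fin n) × Bool → MvPolynomial (Fin n × Fin n) k) :
    finVec k n w ᵥ* bigN k n = 0 := by
  funext v
  simp [Matrix.vecMul, dotProduct, Fintype.sum_sum_type, finVec]

/-- The source feeds layer `0`. [folklore] -/
theorem srcVec_eq : srcVec k n = layerVec k n 0 (startp k n) := rfl

/-- **Paths of the branching program**: after `d ≤ n` internal edges the source vector sits on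
layer `d` as `startp · Tp^d`, and — for `d = n` — on the pre-sinks as the closed heads of the
last layer. [cite: GrenetEtAl2011, Thm 5 (proof)] -/
theorem srcVec_vecMul_pow (hn : n ≠ 0) {d : ℕ} (hd : d ≤ n) :
    srcVec k n ᵥ* bigN k n ^ d = layerVec k n d (startp k n ᵥ* Tp k n ^ d) +
      if d = n then finVec k n (startp k n ᵥ* Tp k n ^ (n - 1)) else 0 := by
  induction d with
  | zero =>
    rw [pow_zero, pow_zero, Matrix.vecMul_one, Matrix.vecMul_one, if_neg (Ne.symm hn), add_zero]
    rfl
  | succ d ih =>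
    rw [pow_succ, ← Matrix.vecMul_vecMul, ih (Nat.le_of_succ_le hd), if_neg (by omega), add_zero,
      layerVec_vecMul, pow_succ, ← Matrix.vecMul_vecMul]
    by_cases h : d + 1 = n
    · rw [if_pos h, if_pos h]
      have : n - 1 = d := by omega
      rw [this]
    · rw [if_neg h, if_neg h]

/-- Layer vectors are orthogonal to the sink vector. [folklore] -/
theorem layerVec_dotProduct_snkVec (d : ℕ)
    (w : (Fin n × Fin n) × Bool → MvPolynomial (Fin n × Fin n) k) :
    layerVec k n d w ⬝ᵥ snkVec k n = 0 := by
  simp [layerVec, snkVec, dotProduct, Fintype.sum_sum_type]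

/-- The pre-sink vector against the sink weights `±1`: the signed sum over the closed heads.
[cite: GrenetEtAl2011, Thm 5 (proof)] -/
theorem finVec_dotProduct_snkVec (w : (Fin n × Fin n) × Bool → MvPolynomial (Fin n × Fin n) k) :
    finVec k n w ⬝ᵥ snkVec k n = ∑ t : Fin n, sg k n w (t, t) := by
  simp only [finVec, snkVec, dotProduct, Fintype.sum_sum_type, Sum.elim_inl, Pi.zero_apply,
    mul_zero, Finset.sum_const_zero, zero_add, Sum.elim_inr, Finset.sum_mul]
  rw [Finset.sum_comm]
  simp only [Fintype.sum_prod_type, sg]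
  -- ∑ t, ∑ u, ∑ π, ∑ π', w ((t,u),π) * [u = t ∧ π = π'] * sgnB π' = ∑ t, ∑ π, sgnB π * w ((t,t),π)
  refine Finset.sum_congr rfl fun t _ => ?_
  have h : ∀ u : Fin n, ∑ π : Bool, ∑ π' : Bool,
      w ((t, u), π) * (if u = t ∧ π = π' then 1 else 0) * sgnB k n π' =
        if u = t then ∑ π : Bool, sgnB k n π * w ((t, t), π) else 0 := by
    intro u
    by_cases hu : u = t
    · simp only [hu, true_and, ite_true]
      refine Finset.sum_congr rfl fun π _ => ?_
      rw [Fintype.sum_bool]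
      cases π <;> simp [mul_comm]
    · simp [hu]
  rw [Finset.sum_congr rfl fun u _ => h u, Finset.sum_ite_eq', if_pos (Finset.mem_univ _)]

/-- **The value of the branching program is the generic determinant**:
`a · (1 + N)⁻¹ · b = DET_n` (for `n ≠ 0`). [cite: GrenetEtAl2011, Thm 5 (proof)] -/
theorem abpValue_eq_detPoly (hn : n ≠ 0) :
    abpValue (geomInv (bigN k n) (n + 1)) (srcVec k n) (snkVec k n) = detPoly (Fin n) k := by
  have h1 : 1 ≤ n := Nat.one_le_iff_ne_zero.2 hn
  have hsg : sg k n (startp k n ᵥ* Tp k n ^ (n - 1)) = fun σ' => sv k n n σ'.1 σ'.2 := by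
    rw [sg_startp_vecMul_pow, Nat.sub_add_cancel h1]
  have hterm : ∀ j ∈ range (n + 1), (srcVec k n ᵥ* (-bigN k n) ^ j) ⬝ᵥ snkVec k n =
      if j = n then (-1) ^ n * ∑ t ∈ range n, sv k n n t t else 0 := by
    intro j hj
    have hj' : j ≤ n := Nat.lt_succ_iff.1 (mem_range.1 hj)
    rw [← neg_one_smul (MvPolynomial (Fin n × Fin n) k) (bigN k n), smul_pow,
      Matrix.vecMul_smul, smul_dotProduct, smul_eq_mul, srcVec_vecMul_pow hn hj',
      add_dotProduct, layerVec_dotProduct_snkVec, zero_add]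
    by_cases hjn : j = n
    · rw [if_pos hjn, if_pos hjn, hjn]
      simp only [finVec_dotProduct_snkVec, hsg]
      rw [Fin.sum_univ_eq_sum_range (fun t => sv k n n t t) n]
    · rw [if_neg hjn, if_neg hjn, zero_dotProduct, mul_zero]
  unfold abpValue geomInv
  rw [Matrix.dotProduct_mulVec, Matrix.vecMul_sum, sum_dotProduct, Finset.sum_congr rfl hterm,
    Finset.sum_ite_eq', if_pos (by simp), sum_sv_diag, if_neg hn, sub_zero, detPoly,
    ← genBlock_self, Matrix.det_eq_sign_charpoly_coeff, Fintype.card_fin]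
  rfl

end Program

/-! ## Assembly: the symmetric matrix of dimension `4n³ + 7` -/

section Assembly

variable (k : Type u) [Field k] (n : ℕ)

/-- The admissible entries of GKKP's Thm. 5: a variable `x_{ij}` or one of `0, 1, -1, 1/2` — the
disjunction of `GKKP2011_detPoly_symmetric`, verbatim. [cite: GrenetEtAl2011, Thm 5] -/
def IsEntry (y : MvPolynomial (Fin n × Fin n) k) : Prop :=
  (∃ ij : Fin n × Fin n, y = X ij) ∨ y = 0 ∨ y = 1 ∨ y = -1 ∨ y = C (2⁻¹ : k)

variable {k n}

/-- `0` is admissible. [folklore] -/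
theorem isEntry_zero : IsEntry k n 0 := Or.inr (Or.inl rfl)

/-- `1` is admissible. [folklore] -/
theorem isEntry_one : IsEntry k n 1 := Or.inr (Or.inr (Or.inl rfl))

/-- `-1` is admissible. [folklore] -/
theorem isEntry_neg_one : IsEntry k n (-1) := Or.inr (Or.inr (Or.inr (Or.inl rfl)))

/-- `1/2` is admissible. [folklore] -/
theorem isEntry_half : IsEntry k n (C (2⁻¹ : k)) := Or.inr (Or.inr (Or.inr (Or.inr rfl)))

/-- A variable is admissible. [folklore] -/
theorem isEntry_X (ij : Fin n × Fin n) : IsEntry k n (X ij) := Or.inl ⟨ij, rfl⟩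

/-- Admissibility is closed under case distinctions. [folklore] -/
theorem isEntry_ite {p : Prop} [Decidable p] {a b : MvPolynomial (Fin n × Fin n) k}
    (ha : IsEntry k n a) (hb : IsEntry k n b) : IsEntry k n (if p then a else b) := by
  split_ifs
  exacts [ha, hb]

/-- `xvar a b` is a variable or `0`. [folklore] -/
theorem isEntry_xvar (a b : ℕ) : IsEntry k n (xvar k n a b) := by
  unfold xvar
  split_ifs
  exacts [isEntry_X _, isEntry_zero]

/-- Every edge weight of the parity-doubled program is a variable or `0`. [folklore] -/
theorem isEntry_stepWp (f t' u' : ℕ) (π π' : Bool) : IsEntry k n (stepWp k n f t' u' π π') :=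
  isEntry_ite (isEntry_ite (isEntry_xvar _ _) isEntry_zero)
    (isEntry_ite (isEntry_ite (isEntry_xvar _ _) isEntry_zero) isEntry_zero)

/-- Every entry of the transfer matrix is a variable or `0`. [folklore] -/
theorem isEntry_Tp (s s' : (Fin n × Fin n) × Bool) : IsEntry k n (Tp k n s s') :=
  isEntry_ite (isEntry_ite (isEntry_stepWp _ _ _ _ _) isEntry_zero)
    (isEntry_ite (isEntry_ite (isEntry_stepWp _ _ _ _ _) isEntry_zero) isEntry_zero)

/-- `sgnB π = ±1` is admissible. [folklore] -/
theorem isEntry_sgnB (π : Bool) : IsEntry k n (sgnB k n π) :=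
  isEntry_ite isEntry_neg_one isEntry_one

/-- Every entry of the internal adjacency matrix is a variable, `0` or `1`. [folklore] -/
theorem isEntry_bigN (v v' : Vtx n) : IsEntry k n (bigN k n v v') := by
  rcases v with p | π <;> rcases v' with p' | π'
  · rw [bigN_inl_inl]; exact isEntry_ite (isEntry_Tp _ _) isEntry_zero
  · rw [bigN_inl_inr]; exact isEntry_ite isEntry_one isEntry_zero
  · rw [bigN_inr]; exact isEntry_zero
  · rw [bigN_inr]; exact isEntry_zero

/-- The source weights are variables or `0`. [folklore] -/
theorem isEntry_srcVec (v : Vtx n) : IsEntry k n (srcVec k n v) := by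
  rcases v with p | π
  · exact isEntry_ite (isEntry_stepWp _ _ _ _ _) isEntry_zero
  · exact isEntry_zero

/-- The sink weights are `±1` or `0`. [folklore] -/
theorem isEntry_snkVec (v : Vtx n) : IsEntry k n (snkVec k n v) := by
  rcases v with p | π
  · exact isEntry_zero
  · exact isEntry_sgnB _

/-- No loops: `bigN v v = 0`. [folklore] -/
theorem bigN_apply_self (v : Vtx n) : bigN k n v v = 0 := by
  by_contra h
  have := bigN_isLayered (k := k) (n := n) v v h
  omega

/-- **Every entry of the symmetric matrix is a variable or one of `0, 1, -1, 1/2`** (GKKP Thm. 5: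
"entries in `{x_{i,j}} ∪ {0; 1; −1; 1/2}`"). [cite: GrenetEtAl2011, Thm 5] -/
theorem isEntry_symOfABP (v v' : Fin 3 ⊕ (Vtx n ⊕ Vtx n)) :
    IsEntry k n (symOfABP (bigN k n) (srcVec k n) (snkVec k n) (-1) (C (2⁻¹ : k)) v v') := by
  rcases v with i | x <;> rcases v' with j | y
  · rw [symOfABP, Matrix.fromBlocks_apply₁₁, cornerBlock]
    fin_cases i <;> fin_cases j
    exacts [isEntry_zero, isEntry_neg_one, isEntry_half, isEntry_neg_one, isEntry_zero,
      isEntry_zero, isEntry_half, isEntry_zero, isEntry_zero]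
  · rw [symOfABP, Matrix.fromBlocks_apply₁₂, borderBlock, Matrix.of_apply]
    fin_cases i
    · exact isEntry_zero
    · rcases y with v | v
      · exact isEntry_srcVec _
      · exact isEntry_zero
    · rcases y with v | v
      · exact isEntry_zero
      · exact isEntry_snkVec _
  · rw [symOfABP, Matrix.fromBlocks_apply₂₁, Matrix.transpose_apply, borderBlock, Matrix.of_apply]
    fin_cases j
    · exact isEntry_zero
    · rcases x with v | v
      · exact isEntry_srcVec _
      · exact isEntry_zero
    · rcases x with v | v
      · exact isEntry_zero
      · exact isEntry_snkVec _
  · rw [symOfABP, Matrix.fromBlocks_apply₂₂, midBlock]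
    rcases x with a | a <;> rcases y with b | b
    · rw [Matrix.fromBlocks_apply₁₁]; exact isEntry_zero
    · rw [Matrix.fromBlocks_apply₁₂, Matrix.add_apply, Matrix.transpose_apply]
      by_cases hab : a = b
      · subst hab
        rw [Matrix.one_apply_eq, bigN_apply_self, add_zero]; exact isEntry_one
      · rw [Matrix.one_apply_ne hab, zero_add]; exact isEntry_bigN _ _
    · rw [Matrix.fromBlocks_apply₂₁, Matrix.add_apply]
      by_cases hab : a = b
      · subst hab
        rw [Matrix.one_apply_eq, bigN_apply_self, add_zero]; exact isEntry_one
      · rw [Matrix.one_apply_ne hab, zero_add]; exact isEntry_bigN _ _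
    · rw [Matrix.fromBlocks_apply₂₂]; exact isEntry_zero

/-- The dimension count of GKKP's Thm. 5: `3 + 2 · (2n³ + 2) = 4n³ + 7`.
[cite: GrenetEtAl2011, Thm 5 (proof)] -/
theorem card_index : Fintype.card (Fin 3 ⊕ (Vtx n ⊕ Vtx n)) = 4 * n ^ 3 + 7 := by
  simp only [Fintype.card_sum, Fintype.card_fin, Fintype.card_prod, Fintype.card_bool]
  ring

variable (k n)

/-- **GKKP Thm. 5 for `n ≠ 0`**, on `Fin (4n³ + 7)`: the re-indexed matrix `symOfABP` of the
determinant program with `ε = -1`, `η = 1/2`. [cite: GrenetEtAl2011, Thm 5] -/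
theorem exists_symmetric_detPoly (h2 : (2 : k) ≠ 0) (hn : n ≠ 0) :
    ∃ M : Matrix (Fin (4 * n ^ 3 + 7)) (Fin (4 * n ^ 3 + 7)) (MvPolynomial (Fin n × Fin n) k),
      M.IsSymm ∧ (∀ a b, IsEntry k n (M a b)) ∧ M.det = detPoly (Fin n) k := by
  -- a local shortcut keeping the synthesized `DecidableEq` instance of the index type small
  letI : DecidableEq (Vtx n ⊕ Vtx n) := instDecidableEqSum
  let e : Fin 3 ⊕ (Vtx n ⊕ Vtx n) ≃ Fin (4 * n ^ 3 + 7) := Fintype.equivFinOfCardEq card_index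
  let M₀ := symOfABP (bigN k n) (srcVec k n) (snkVec k n) (-1) (C (2⁻¹ : k))
  refine ⟨Matrix.reindex e e M₀, ?_, ?_, ?_⟩
  · exact (isSymm_symOfABP _ _ _ _ _).submatrix _
  · intro a b
    exact isEntry_symOfABP (e.symm a) (e.symm b)
  · rw [Matrix.det_reindex_self, det_symOfABP (bigN k n) (geomInv (bigN k n) (n + 1))
      (one_add_mul_geomInv bigN_pow_eq_zero) det_one_add_bigN, abpValue_eq_detPoly hn]
    have hV : Even (Fintype.card (Vtx n)) := by
      simp only [Fintype.card_sum, Fintype.card_prod, Fintype.card_fin, Fintype.card_bool]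
      exact ⟨n * (n * n) + 1, by ring⟩
    have h2' : (2 : MvPolynomial (Fin n × Fin n) k) * C (2⁻¹ : k) = 1 := by
      rw [show (2 : MvPolynomial (Fin n × Fin n) k) = C 2 from (map_ofNat C 2).symm, ← C_mul,
        mul_inv_cancel₀ h2, C_1]
    rw [Even.neg_one_pow hV, one_mul]
    linear_combination detPoly (Fin n) k * h2'

end Assembly

end PartB

end GKKP2011

/-- **Grenet–Kaltofen–Koiran–Portier 2011, Thm. 5 (Mahajan–Nimbhorkar)** — discharge of the named
fact `GKKP2011_detPoly_symmetric`: over a field with `2 ≠ 0`, for every `n` the generic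
determinant `DET_n` is `det M` for a symmetric `M` of dimension `4n³ + 7` with entries in
`{x_{ij}} ∪ {0, 1, -1, 1/2}` (for `n = 0`: the identity matrix of size `7`).
[cite: GrenetEtAl2011, Thm 5] -/
theorem GKKP2011_detPoly_symmetric_holds : GKKP2011_detPoly_symmetric := by
  intro k _ h2 n
  by_cases hn : n = 0
  · subst hn
    refine ⟨1, Matrix.isSymm_one, fun a b => ?_, ?_⟩
    · by_cases hab : a = b
      · subst hab
        exact Or.inr (Or.inr (Or.inl (Matrix.one_apply_eq a)))
      · exact Or.inr (Or.inl (Matrix.one_apply_ne hab))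
    · rw [Matrix.det_one, detPoly]
      exact Matrix.det_isEmpty.symm
  · exact GKKP2011.exists_symmetric_detPoly k n h2 hn

end Literature.Computability.AlgebraicComplexity
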